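/-
Copyright: the b2b-balaban cell (near-miss cell 7), T⁴-continuum fan-out; row NE7b ROUND-2 swarm, seat
t4-ne7b-formalise-leaf-05 (row S6e part 2b of `t4/b2b-balaban-t4-ne7b-p1/LEAVES-NE7b.md`).  Released under the licence of the
surrounding project.
-/
import Summits.QuantumFields.BalabanUV.T4Continuum.Support.HistoryZoneSurcharge
import Summits.QuantumFields.BalabanUV.T4Continuum.Support.HistoryCrowdingTagged

/-!
# Row NE7b, leaf S6e part 2b: the TH exit with the zone binder ON THE TAGGED TREE (births-genericity displayed)

Summits-side support leaf of the T⁴-continuum cell (rung (B)+1 on a FINITE torus only; NOT infinite volume, NOT the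
mass gap, NOT the Clay statement; NOT a proof of the spine estimate NE7b).  Row S6e, RULING R-OWNER-22-9 («GO leaf-05 (R-a)
part 2»): the zone-crowding binder is now read on the TAGGED genealogy `G′ : Gen ε` — multiplicity
`Kz^{#merges G′}·∏_{e ∈ merges G′} Q(wcntS sh G′, σ, (sh e).step)^p·Λ′^{partnerAges (step∘sh) G′}`, exactly what row S6
delivers (`HistoryZones.card_admZSet_le_of_readingS`) — and the displayed genericity WEAKENS from v1's `InjOn sh events` to
**`BirthShapeNodup`** = `Set.InjOn sh ↑(births G′)` (TypeNodup on births only; merger∕renewal labels free).  [folklore]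
bookkeeping over the lineage's OWN carrier (`HistoryCrowdingTagged.zone_surchargeS_le`, `HistoryZoneSurcharge`); nothing
printed asserted, no `[cite:]`, no `def … : Prop` fact (c1); constants SYMBOLIC (c2∕c6).

WHAT.  §1 step data of a consistent tagged genealogy (`stepsOK_of_consistentTH`, `ordered_of_consistentTH`).  §2 the named
threshold `irThresholdZTHD sh C Kz p σ ε θ L r β₀ D := irThresholdGTH sh C (zoneRate …) L r β₀ D` (`irThresholdZTH` is its
`D = 0` case) and **`relWeightBound_lateMergersZS_of_irThreshold`**: the TH exit
`CountThresholdExit.relWeightBound_lateMergers_of_irThreshold` (ANY horizon `D`, `Δ ≥ 1`) with the placement rate `Λ′e^{ε}`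
in its two rate conditions and the binder **`hlabZS`** — the slot price is `≤ 0` or at most `Δ·(tagged (GM) multiplicity)·
e^{−credits∘sh}·e^{+lifeCost}` of a `ConsistentTH`, `FreshT`, BIRTH-SHAPE-GENERIC tagged genealogy pending past `K − D` with
the slot's shape tree; conclusion = the TH exit's VERBATIM.  Proof: `hlabZS ⇒ hlabGTH` by `zone_surchargeS_le` (well
formed over the padded table by `ConsistentTH.wf_padW`, step data by §1, kind-`0` birth shapes by
`kind_eq_zero_of_mem_birthsTH`), then `relWeightBound_lateMergersG_of_irThreshold`; its horizon-`0` dress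
`relWeightBound_lateMergersZS0_of_irThreshold` (`ConsistentT`, `K < reach`, `irThresholdZTH` — the Z exit v1's socket form with the
tagged multiplicity and `InjOn sh ↑(births G′)`).  §3 sanity.

HONEST.  Residual NOT covered (R-OWNER-22-9, booked as row S6g): equal-shape sibling crowds, where `BirthShapeNodup`
fails (F-leaf05-2).  Nothing of H3 ∕ (B) ∕ BetaPertH.  NE7b NOT proved.  HONEST DEPENDENCY (cell): continuum YM on T⁴ ⇐
BetaPertH ∧ nine spine estimates (0/9 proved); BetaPertH ⇐ (D1) ∧ (D4) ∧ CAP+tail; G-an2-4 gates asym, D1 and NE2/3/4.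
-/

open Finset
open Literature.MathematicalPhysics.QuantumFieldTheory.Balaban1983to89
open T4PersistenceDictionary T4PersistentHistoryCount T4BankedInduction T4PrintedShapeBanking T4PartnerMultiplicity
open T4WeightBudget T4GlobalDenominator T4LiveClassFibration T4LiveStructureGas T4LiveGasToTerms T4RecordPriceSeam
open T4BranchingRecordsGas T4TaggedShapeBanking T4CanonicalMenus T4CountHorizon T4MatchingClosureSocket
open Summit.QuantumFields.BalabanUV.T4Continuum
open PlacementBatch PlacementSkeleton PartnerMultiplicityF PartnerMultiplicityG PartnerMultiplicityZ
open PartnerMultiplicityFloor PartnerMultiplicityThreshold Crowding CountThresholdUniform CountThresholdExit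
open LateMergers ZoneSkeleton HistoryConsistent HistoryZones HistoryZoneSurcharge HistoryCrowdingTagged

namespace Summit.QuantumFields.BalabanUV.T4Continuum.HistoryZoneSurchargeTagged

noncomputable section

/-! ## §1 Step data of a consistent tagged genealogy -/

section Steps

variable {ε : Type*} {sh : ε → PEv} {C : T4PrintedShapeBanking.Consts} {K : ℕ} {R : ℕ → ℕ} {D : ℕ}

/-- the birth labels of a consistent tagged genealogy are dated by their shapes [folklore] -/
theorem stepsOK_of_consistentTH : ∀ {G : Gen ε}, ConsistentTH sh C K R D G → StepsOK (PEv.step ∘ sh) G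
  | Gen.born _ _, hc => hc.2.1
  | Gen.renew G _ _, hc => show StepsOK (PEv.step ∘ sh) G from stepsOK_of_consistentTH hc.1
  | Gen.merge _ _ _, hc => ⟨stepsOK_of_consistentTH hc.1, stepsOK_of_consistentTH hc.2.1⟩

/-- the mergers of a consistent tagged genealogy are ordered (`rootStep ≤ step ≤ step + 1`) [folklore] -/
theorem ordered_of_consistentTH : ∀ {G : Gen ε}, ConsistentTH sh C K R D G → Ordered (PEv.step ∘ sh) G
  | Gen.born _ _, _ => trivial
  | Gen.renew G _ _, hc => show Ordered (PEv.step ∘ sh) G from ordered_of_consistentTH hc.1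
  | Gen.merge _ _ _, hc => ⟨ordered_of_consistentTH hc.1, ordered_of_consistentTH hc.2.1,
      Nat.le_succ_of_le hc.2.2.2.1, Nat.le_succ_of_le hc.2.2.2.2.2.1⟩

end Steps

/-! ## §2 The TH exit with the zone binder on the tagged tree, every horizon `D` -/

/-- **THE ZONE TH THRESHOLD AT HORIZON `D`, NAMED**: the class-linear one at the zone rate. [folklore] -/
def irThresholdZTHD {ε : Type*} [DecidableEq ε] (sh : ε → PEv) (C : T4PrintedShapeBanking.Consts)
    (Kz p σ ε θ : ℝ) (L r : ℕ) (β₀ : ℝ) (D : ℕ) : ℝ :=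
  irThresholdGTH sh C (zoneRate Kz p σ ε θ) L r β₀ D

/-- at horizon `0` it is `irThresholdZTH` [folklore] -/
theorem irThresholdZTHD_zero {ε : Type*} [DecidableEq ε] (sh : ε → PEv) (C : T4PrintedShapeBanking.Consts)
    (Kz p σ ε θ : ℝ) (L r : ℕ) (β₀ : ℝ) : irThresholdZTHD sh C Kz p σ ε θ L r β₀ 0 = irThresholdZTH sh C Kz p σ ε θ L r β₀ :=
  rfl

section EndToEnd

variable {ε : Type*} [DecidableEq ε]
variable {γ κ ι : Type*} [DecidableEq γ] [DecidableEq κ] {l₀ : ℝ} {K₀ : ℕ} {π : ℕ → ι → κ} {T : ℕ → Finset ι}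
  {A A' : ℕ → ℝ → ι → ℝ} {Bad' : ℕ → ℝ → Finset κ} {dead dead' : ℕ → ℝ → ι → ℝ} {F Rf F' Rf' : ℕ → κ → ℝ}
  {nlow nup mlow mup : ℕ → ℝ → ℝ} {Cn : ℝ}

/-- **THE TH EXIT WITH THE ZONE-CROWDING BINDER ON THE TAGGED TREE (`hlabZS`), EVERY HORIZON, THRESHOLD NAMED.**
`relWeightBound_lateMergersG_of_irThreshold` at `θ := zoneRate Kz p σ ε θ`, `Λ′ := Λ′e^{ε}`, with the binder `hlabZS`: the slot
price is `≤ 0` or at most `Δ·Kz^{#merges G′}·(∏_{e ∈ merges G′} Q(wcntS sh G′, σ, (sh e).step)^p)·Λ′^{partnerAges (step∘sh) G′}·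
e^{−credits (credit C g_K ∘ sh) G′}·e^{+lifeCost (padW …) (costT …) G′}` for SOME `ConsistentTH … D`, fresh, BIRTH-SHAPE-GENERIC
(`Set.InjOn sh ↑(births G′)`) tagged genealogy pending past `K − D` with the slot's shape tree.  The two Λ′-rate conditions
are stated at `Λ′·e^{ε}`; conclusion = the TH exit's VERBATIM. [folklore] -/
theorem relWeightBound_lateMergersZS_of_irThreshold (sh : ε → PEv) {C : T4PrintedShapeBanking.Consts} {L r : ℕ}
    {β₀ : ℝ} (h : ThresholdOK C L r β₀) (hμ₀ : 0 < C.μ)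
    {Kz p σ ε' θ : ℝ} (hKz : 1 ≤ Kz) (hp : 0 ≤ p) (h0 : 0 < σ) (h1σ : σ < 1) (hε : 0 < ε') (hθ : 0 < θ)
    (Cell : ℕ → ℕ → Finset γ) {V Λ : ℝ} (hV : 0 ≤ V) (hΛ : 0 < Λ)
    (hcell : ∀ K a, ((Cell K a).card : ℝ) ≤ V * Λ ^ a) (Dcap Ncap : ℕ → ℕ)
    (jstar : ℕ → ℕ) (hj : ∀ K, jstar K ≤ K) {c : ℝ} (hc : 0 < c)
    (hfrac : ∀ K : ℕ, c * K ≤ ((K - jstar K : ℕ) : ℝ)) (D : ℕ) {Δ : ℝ} (hΔ : 1 ≤ Δ)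
    (hA : Regeneration l₀ π T A Bad' dead F Rf nlow nup Cn K₀)
    (hA' : Regeneration l₀ π T A' Bad' dead' F' Rf' mlow mup Cn K₀) (hCn : 0 ≤ Cn)
    (R : ℕ → ℕ → ℕ) (g : ℕ → ℕ → ℝ) (β' : ℕ → ℝ)
    (h27 : ∀ K, K₀ ≤ K → B14.FlowIneq27 (g K) (β' K) β₀ C.p₀ K)
    (h29 : ∀ K, K₀ ≤ K → B14FlowStep.FlowIneq29 (R K) (g K) L (β' K) β₀ K)
    (hR : ∀ K, K₀ ≤ K → ∀ s, s ≤ K → B14.IsRj L r (g K s) (R K s))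
    (hx1 : ∀ K, K₀ ≤ K → ∀ s, s ≤ K → 1 ≤ Real.log ((g K s) ^ 2)⁻¹)
    (hir : ∀ K, K₀ ≤ K → irThresholdZTHD sh C Kz p σ ε' θ L r β₀ D ≤ Real.log ((g K K) ^ 2)⁻¹)
    (hP : ∀ K s, 0 ≤ p0Profile C.A₀ C.p₀ (g K s))
    {ηplus : ℝ} (hηplus : 0 ≤ ηplus) (hr : Λ * Real.exp (ηplus - C.κ₁) < 1)
    {Λ' : ℝ} (hΛ0 : 0 ≤ Λ') (h1 : Λ' * Real.exp ε' * Real.exp (-C.κ₁) * Real.exp ηplus < 1)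
    (hx : (Real.exp (-C.E₀) + Real.exp (-C.E₀) * birthMass C *
          (Λ' * Real.exp ε' * Real.exp (-C.κ₁) / (1 - Λ' * Real.exp ε' * Real.exp (-C.κ₁) * Real.exp ηplus))) *
          Real.exp ηplus ≤
        Real.exp ηplus - 1)
    (y : ℕ → ℕ → γ → Gen PEv → ℝ)
    (hy0 : ∀ K, ∀ j ≤ K, ∀ z ∈ Cell K (K - j), ∀ G ∈ canonFam Dcap Ncap K j, 0 ≤ y K j z G)
    (hlabZS : ∀ K, K₀ ≤ K → ∀ j ≤ K, ∀ z ∈ Cell K (K - j), ∀ G ∈ canonFam Dcap Ncap K j,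
      y K j z G ≤ 0 ∨ ∃ G' : Gen ε, ConsistentTH sh C K (R K) D G' ∧ FreshT G' ∧ Set.InjOn sh ↑(births G') ∧
        K - D < G'.reach (dictWT sh (R K) C.n₁) ∧ relabel (shape ∘ sh) G' = G ∧
        y K j z G ≤ Δ * (Kz ^ (merges G').card *
          (∏ e ∈ merges G', Crowding.Q (wcntS sh G') σ (sh e).step ^ p) *
          Λ' ^ partnerAges (PEv.step ∘ sh) G' * (Real.exp (-credits (credit C (g K) ∘ sh) G') *
            Real.exp (lifeCost (padW (dictWT sh (R K) C.n₁) D) (costT sh C K (R K)) G'))))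
    (str : ℕ → κ → Finset (BSlot γ PEv))
    (hinj : ∀ K t, |t| ≤ l₀ → K₀ ≤ K → Set.InjOn (str K) (Bad' K t))
    (hstr : ∀ K t, |t| ≤ l₀ → K₀ ≤ K → ∀ c ∈ Bad' K t,
      str K c ⊆ bliveSlots Cell (canonFam Dcap Ncap) K ∧
        ∃ o ∈ boldSlots Cell (canonFam Dcap Ncap) jstar K, o ∈ str K c)
    (hF : ∀ K t, |t| ≤ l₀ → K₀ ≤ K → ∀ c ∈ Bad' K t, F K c * Rf K c ≤ famWeight (bslotPrice (y K)) (str K c))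
    (hF' : ∀ K t, |t| ≤ l₀ → K₀ ≤ K → ∀ c ∈ Bad' K t, F' K c * Rf' K c ≤ famWeight (bslotPrice (y K)) (str K c)) :
    ∃ K₁, K₀ ≤ K₁ ∧ RelWeightBound l₀ T A A' (fun K t => if K₁ ≤ K then badOfClass π T Bad' K t else ∅)
      (Set.indicator {K | K₁ ≤ K}
        (fun K => Cn * recordsBudget (Δ * Real.exp (C.κ₁ * (D : ℝ)) * birthMass C) C.κ₁ V Λ ηplus jstar K)) := by
  have hθz : 0 ≤ zoneRate Kz p σ ε' θ := zoneRate_nonneg hKz hp h0 h1σ hθ.le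
  have hΛ0' : 0 ≤ Λ' * Real.exp ε' := mul_nonneg hΛ0 (Real.exp_pos ε').le
  have hΔ0 : 0 ≤ Δ := zero_le_one.trans hΔ
  have hlabGTH : ∀ K, K₀ ≤ K → ∀ j ≤ K, ∀ z ∈ Cell K (K - j), ∀ G ∈ canonFam Dcap Ncap K j,
      y K j z G ≤ 0 ∨ ∃ G' : Gen ε, ConsistentTH sh C K (R K) D G' ∧ FreshT G' ∧
        K - D < G'.reach (dictWT sh (R K) C.n₁) ∧ relabel (shape ∘ sh) G' = G ∧
        y K j z G ≤ Δ * (Real.exp (zoneRate Kz p σ ε' θ * ∑ b ∈ births G', ((((sh b).fat : ℕ) : ℝ) + 1)) *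
          ((Λ' * Real.exp ε') ^ partnerAges (PEv.step ∘ sh) G' * (Real.exp (-credits (credit C (g K) ∘ sh) G') *
            Real.exp (lifeCost (padW (dictWT sh (R K) C.n₁) D) (costT sh C K (R K)) G')))) := by
    intro K hK j hjK z hz G hG
    rcases hlabZS K hK j hjK z hz G hG with h0' | ⟨G', hcG, hfG, hinjB, hKr, hsh, hy⟩
    · exact Or.inl h0'
    · refine Or.inr ⟨G', hcG, hfG, hKr, hsh, hy.trans ?_⟩
      -- the zone surcharge of the tagged tree is class-linear (births shape-generic)
      have key := zone_surchargeS_le (sh := sh) (W := padW (dictWT sh (R K) C.n₁) D) hKz hp h0 h1σ hε hθ hΛ0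
        (ConsistentTH.wf_padW hcG hfG) (stepsOK_of_consistentTH hcG) (ordered_of_consistentTH hcG)
        (kind_eq_zero_of_mem_birthsTH hcG) hinjB
      set Xr := Real.exp (-credits (credit C (g K) ∘ sh) G') *
        Real.exp (lifeCost (padW (dictWT sh (R K) C.n₁) D) (costT sh C K (R K)) G')
      set M := Kz ^ (merges G').card * (∏ e ∈ merges G', Crowding.Q (wcntS sh G') σ (sh e).step ^ p)
      have hX : 0 ≤ Xr := by positivity
      calc Δ * (M * Λ' ^ partnerAges (PEv.step ∘ sh) G' * Xr)
          = Δ * ((M * Λ' ^ partnerAges (PEv.step ∘ sh) G') * Xr) := by ring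
        _ ≤ Δ * ((Real.exp (zoneRate Kz p σ ε' θ * ∑ b ∈ births G', ((((sh b).fat : ℕ) : ℝ) + 1)) *
              (Λ' * Real.exp ε') ^ partnerAges (PEv.step ∘ sh) G') * Xr) := by gcongr
        _ = _ := by ring
  exact relWeightBound_lateMergersG_of_irThreshold sh h hμ₀ hθz Cell hV hΛ hcell Dcap Ncap jstar hj hc hfrac D hΔ hA
    hA' hCn R g β' h27 h29 hR hx1 hir hP hηplus hr hΛ0' (by simpa [mul_assoc] using h1)
    (by simpa [mul_assoc] using hx) y hy0 hlabGTH str hinj hstr hF hF'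

/-- **THE SAME AT HORIZON `0`, IN THE Z EXIT v1's DRESS** (socket form: `ConsistentT`, `K < reach`, threshold
`irThresholdZTH`): `relWeightBound_lateMergersZ_of_irThreshold` with the multiplicity read on the TAGGED tree and the genericity
weakened to `Set.InjOn sh ↑(births G′)`; conclusion VERBATIM (`e^{κ₁·0}` kept, as there). [folklore] -/
theorem relWeightBound_lateMergersZS0_of_irThreshold (sh : ε → PEv) {C : T4PrintedShapeBanking.Consts} {L r : ℕ}
    {β₀ : ℝ} (h : ThresholdOK C L r β₀) (hμ₀ : 0 < C.μ)
    {Kz p σ ε' θ : ℝ} (hKz : 1 ≤ Kz) (hp : 0 ≤ p) (h0 : 0 < σ) (h1σ : σ < 1) (hε : 0 < ε') (hθ : 0 < θ)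
    (Cell : ℕ → ℕ → Finset γ) {V Λ : ℝ} (hV : 0 ≤ V) (hΛ : 0 < Λ)
    (hcell : ∀ K a, ((Cell K a).card : ℝ) ≤ V * Λ ^ a) (Dcap Ncap : ℕ → ℕ)
    (jstar : ℕ → ℕ) (hj : ∀ K, jstar K ≤ K) {c : ℝ} (hc : 0 < c)
    (hfrac : ∀ K : ℕ, c * K ≤ ((K - jstar K : ℕ) : ℝ)) {Δ : ℝ} (hΔ : 1 ≤ Δ)
    (hA : Regeneration l₀ π T A Bad' dead F Rf nlow nup Cn K₀)
    (hA' : Regeneration l₀ π T A' Bad' dead' F' Rf' mlow mup Cn K₀) (hCn : 0 ≤ Cn)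
    (R : ℕ → ℕ → ℕ) (g : ℕ → ℕ → ℝ) (β' : ℕ → ℝ)
    (h27 : ∀ K, K₀ ≤ K → B14.FlowIneq27 (g K) (β' K) β₀ C.p₀ K)
    (h29 : ∀ K, K₀ ≤ K → B14FlowStep.FlowIneq29 (R K) (g K) L (β' K) β₀ K)
    (hR : ∀ K, K₀ ≤ K → ∀ s, s ≤ K → B14.IsRj L r (g K s) (R K s))
    (hx1 : ∀ K, K₀ ≤ K → ∀ s, s ≤ K → 1 ≤ Real.log ((g K s) ^ 2)⁻¹)
    (hir : ∀ K, K₀ ≤ K → irThresholdZTH sh C Kz p σ ε' θ L r β₀ ≤ Real.log ((g K K) ^ 2)⁻¹)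
    (hP : ∀ K s, 0 ≤ p0Profile C.A₀ C.p₀ (g K s))
    {ηplus : ℝ} (hηplus : 0 ≤ ηplus) (hr : Λ * Real.exp (ηplus - C.κ₁) < 1)
    {Λ' : ℝ} (hΛ0 : 0 ≤ Λ') (h1 : Λ' * Real.exp ε' * Real.exp (-C.κ₁) * Real.exp ηplus < 1)
    (hx : (Real.exp (-C.E₀) + Real.exp (-C.E₀) * birthMass C *
          (Λ' * Real.exp ε' * Real.exp (-C.κ₁) / (1 - Λ' * Real.exp ε' * Real.exp (-C.κ₁) * Real.exp ηplus))) *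
          Real.exp ηplus ≤
        Real.exp ηplus - 1)
    (y : ℕ → ℕ → γ → Gen PEv → ℝ)
    (hy0 : ∀ K, ∀ j ≤ K, ∀ z ∈ Cell K (K - j), ∀ G ∈ canonFam Dcap Ncap K j, 0 ≤ y K j z G)
    (hlabZS0 : ∀ K, K₀ ≤ K → ∀ j ≤ K, ∀ z ∈ Cell K (K - j), ∀ G ∈ canonFam Dcap Ncap K j,
      y K j z G ≤ 0 ∨ ∃ G' : Gen ε, ConsistentT sh C K (R K) G' ∧ FreshT G' ∧ Set.InjOn sh ↑(births G') ∧
        K < G'.reach (dictWT sh (R K) C.n₁) ∧ relabel (shape ∘ sh) G' = G ∧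
        y K j z G ≤ Δ * (Kz ^ (merges G').card *
          (∏ e ∈ merges G', Crowding.Q (wcntS sh G') σ (sh e).step ^ p) *
          Λ' ^ partnerAges (PEv.step ∘ sh) G' * (Real.exp (-credits (credit C (g K) ∘ sh) G') *
            Real.exp (lifeCost (padW (dictWT sh (R K) C.n₁) 0) (costT sh C K (R K)) G'))))
    (str : ℕ → κ → Finset (BSlot γ PEv))
    (hinj : ∀ K t, |t| ≤ l₀ → K₀ ≤ K → Set.InjOn (str K) (Bad' K t))
    (hstr : ∀ K t, |t| ≤ l₀ → K₀ ≤ K → ∀ c ∈ Bad' K t,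
      str K c ⊆ bliveSlots Cell (canonFam Dcap Ncap) K ∧
        ∃ o ∈ boldSlots Cell (canonFam Dcap Ncap) jstar K, o ∈ str K c)
    (hF : ∀ K t, |t| ≤ l₀ → K₀ ≤ K → ∀ c ∈ Bad' K t, F K c * Rf K c ≤ famWeight (bslotPrice (y K)) (str K c))
    (hF' : ∀ K t, |t| ≤ l₀ → K₀ ≤ K → ∀ c ∈ Bad' K t, F' K c * Rf' K c ≤ famWeight (bslotPrice (y K)) (str K c)) :
    ∃ K₁, K₀ ≤ K₁ ∧ RelWeightBound l₀ T A A' (fun K t => if K₁ ≤ K then badOfClass π T Bad' K t else ∅)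
      (Set.indicator {K | K₁ ≤ K}
        (fun K => Cn * recordsBudget (Δ * Real.exp (C.κ₁ * ((0 : ℕ) : ℝ)) * birthMass C) C.κ₁ V Λ ηplus jstar K)) := by
  refine relWeightBound_lateMergersZS_of_irThreshold sh h hμ₀ hKz hp h0 h1σ hε hθ Cell hV hΛ hcell Dcap Ncap jstar hj
    hc hfrac 0 hΔ hA hA' hCn R g β' h27 h29 hR hx1 hir hP hηplus hr hΛ0 h1 hx y hy0 ?_ str hinj hstr hF hF'
  intro K hK j hjK z hz G hG
  rcases hlabZS0 K hK j hjK z hz G hG with h0' | ⟨G', hcT, hfG, hinjB, hKr, hsh, hy⟩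
  · exact Or.inl h0'
  · exact Or.inr ⟨G', consistentTH_zero_iff.2 hcT, hfG, hinjB, by simpa using hKr, hsh, hy⟩

end EndToEnd

/-! ## §3 Sanity -/

namespace Sanity

/-- the thresholds: horizon-`0` agreement by `rfl`, and `≥ 1` at every horizon [folklore] -/
example {ε : Type*} [DecidableEq ε] (sh : ε → PEv) (C : T4PrintedShapeBanking.Consts) (Kz p σ ε' θ : ℝ)
    (L r : ℕ) (β₀ : ℝ) (D : ℕ) :
    irThresholdZTHD sh C Kz p σ ε' θ L r β₀ 0 = irThresholdZTH sh C Kz p σ ε' θ L r β₀ ∧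
      1 ≤ irThresholdZTHD sh C Kz p σ ε' θ L r β₀ D :=
  ⟨rfl, one_le_irThresholdGTH sh C _ L r β₀ D⟩

/-- the step data of §1 on a decided tagged chain (the cross-read's `C₀`, `R ≡ 2`, horizon `0`) — two class-0 and class-1
regions born at step `0` (distinct shapes), merged at step `1` [folklore] -/
example : StepsOK (PEv.step ∘ (Prod.fst : PEv × ℕ → PEv))
      (Gen.merge (Gen.born (((0, 0, 0) : PEv), 7) 0) (Gen.born (((0, 0, 1) : PEv), 8) 0) (((1, 2, 0) : PEv), 9)) ∧
    Ordered (PEv.step ∘ (Prod.fst : PEv × ℕ → PEv))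
      (Gen.merge (Gen.born (((0, 0, 0) : PEv), 7) 0) (Gen.born (((0, 0, 1) : PEv), 8) 0) (((1, 2, 0) : PEv), 9)) := by
  refine ⟨⟨rfl, rfl⟩, trivial, trivial, ?_, ?_⟩ <;> decide

end Sanity

end

end Summit.QuantumFields.BalabanUV.T4Continuum.HistoryZoneSurchargeTagged
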